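import Summits.Ventures.LatticeQCDFlow.Scaling.ClusteringFloorStrongCoupling

/-!
HONEST FRAMING: exact (Metropolis-corrected) sampling algorithms for lattice gauge theory; figures
of merit are autocorrelation/cost numbers at stated couplings and volumes; no continuum-physics
claim.

# ClusteringFloorExplicit — THE SIGNED, EXPLICIT-RATE FORM OF THE CLUSTERING FLOOR: a floor `δ`
# under the separation-one temporal correlator on one torus gives `δ·(δ/N²)ˢ ≤ ⟨P_x P_{x+s e₀}⟩_c`
# for ALL `s ≤ L − 1` and all sites, at every `β ≥ 0` (lean-1 GEN-11, ours; supplement)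

Venture-side (OURS). Cell `lqcd-flow` (pub-lqcd), unit `pub-lqcd-lean-1-g11`, 2026-08-23.
`ClusteringFloorStrongCoupling.clusteringFloor_of_crossCut` packages the result as the conjecture
(U″) with existential constants.  This file states the same mechanism with the constants in the
open, on ONE torus and WITHOUT an absolute value on the conclusion — the form a reader uses as an
effective-mass bound `m_eff(s) := −(1/s) log(⟨P_0 P_s⟩_c/⟨P_0 P_0⟩_c) ≤ log(N²/δ)`:

* `conjCorr_ge_geometric` — for continuous `ρ`, `β ≥ 0`, `L ≥ 3`, a spatial orientation
  `i, j ≠ 0` and `δ > 0`: if `δ ≤ |⟨P_y P_{y+e₀}⟩ − ⟨P_y⟩⟨P_{y+e₀}⟩|` at every site `y` of THIS torus,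
  then for every `s ≤ L − 1` and every site `x`,
  `δ·(δ/N²)ˢ ≤ ⟨P_x P_{x+s e₀}⟩ − ⟨P_x⟩⟨P_{x+s e₀}⟩` (positive sign included).
* `conjCorr_nonneg_one` — the separation-one truncated correlator is `≥ 0` at every site
  (`β ≥ 0`, `L ≥ 2`; reflection positivity), so the hypothesis may be read without the absolute value.

With gen-10's explicit separation-one floor (`δ = |b| β⁴/2`, `b = N θ⁵`, `θ = 1/2N` for `SU(N ≥ 3)`,
inside `crossCutCorrelatorFloor_of_leadingCoeff`) this reads `⟨P_0 P_s⟩_c ≥ (β⁴/64N⁴)(β⁴/64N⁶)ˢ`,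
i.e. an effective plaquette mass `≤ 4 log(1/β) + log(64 N⁶)` per lattice unit at strong coupling —
NOT restated as a theorem here (the explicit `δ` is internal to gen-10's proof; only the `∃ δ` form
is exported).  NOT CLAIMED: `β < 0`; temporal plaquettes.  [folklore] mechanism.
-/

noncomputable section

namespace Summit.Ventures.LatticeQCDFlow.Theory2.Clustering

open MeasureTheory Literature.MathematicalPhysics.QuantumFieldTheory

variable {d L N : ℕ} [NeZero d] [NeZero L] {G : Type*} [Group G] [TopologicalSpace G]
  [IsTopologicalGroup G] [CompactSpace G] [MeasurableSpace G] [BorelSpace G]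
  [SecondCountableTopology G] (ρ : G →* Matrix (Fin N) (Fin N) ℂ)

omit [SecondCountableTopology G] in
/-- The conjecture's correlator at a general site is the timed correlator of the time-zero
translate (any `L`; the `G : Type*`-polymorphic restatement of `conjCorr_eq_tCorr`). -/
theorem conjCorr_eq_tCorr' (β : ℝ) (x : Site d L) (i j : Fin d) (s : ℕ) :
    wilsonExpectation ρ β (fun U : GaugeConfig d L G =>
        (ρ (plaquetteHolonomy U x i j)).trace.re
          * (ρ (plaquetteHolonomy U (x + Pi.single 0 ((s : ℕ) : ZMod L)) i j)).trace.re)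
      - wilsonExpectation ρ β (fun U : GaugeConfig d L G => (ρ (plaquetteHolonomy U x i j)).trace.re)
        * wilsonExpectation ρ β (fun U : GaugeConfig d L G =>
          (ρ (plaquetteHolonomy U (x + Pi.single 0 ((s : ℕ) : ZMod L)) i j)).trace.re)
      = tCorr ρ β (x - Pi.single (0 : Fin d) (x 0)) i j ((s : ℕ) : ZMod L) := by
  set x₀ : Site d L := x - Pi.single (0 : Fin d) (x 0) with hx₀
  have hx : x₀ + Pi.single (0 : Fin d) (x 0) = x := by rw [hx₀, sub_add_cancel]
  have e1 : (fun U : GaugeConfig d L G => (ρ (plaquetteHolonomy U x i j)).trace.re)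
      = tObs ρ x₀ i j (x 0) := by
    funext U; unfold tObs; rw [hx]
  have e2 : (fun U : GaugeConfig d L G =>
        (ρ (plaquetteHolonomy U (x + Pi.single 0 ((s : ℕ) : ZMod L)) i j)).trace.re)
      = tObs ρ x₀ i j (x 0 + ((s : ℕ) : ZMod L)) := by
    funext U; unfold tObs; rw [Pi.single_add, ← add_assoc, hx]
  have e3 : (fun U : GaugeConfig d L G => (ρ (plaquetteHolonomy U x i j)).trace.re
        * (ρ (plaquetteHolonomy U (x + Pi.single 0 ((s : ℕ) : ZMod L)) i j)).trace.re)
      = fun U => tObs ρ x₀ i j (x 0) U * tObs ρ x₀ i j (x 0 + ((s : ℕ) : ZMod L)) U := by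
    funext U; rw [← e1, ← e2]
  rw [e3, e1, e2, expect_Pobs_mul, expect_Pobs ρ β x₀ i j (x 0),
    expect_Pobs ρ β x₀ i j (x 0 + ((s : ℕ) : ZMod L)), add_sub_cancel_left]
  unfold tCorr
  rw [expect_Pobs ρ β x₀ i j ((s : ℕ) : ZMod L)]

/-- **The separation-one truncated correlator is non-negative at every site** (`β ≥ 0`, `L ≥ 2`,
spatial orientation): reflection positivity. -/
theorem conjCorr_nonneg_one (hL2 : 2 ≤ L) (hρ : Continuous ρ) {β : ℝ} (hβ : 0 ≤ β) {i j : Fin d}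
    (hi : i ≠ 0) (hj : j ≠ 0) (x : Site d L) :
    0 ≤ wilsonExpectation ρ β (fun U : GaugeConfig d L G =>
        (ρ (plaquetteHolonomy U x i j)).trace.re
          * (ρ (plaquetteHolonomy U (x + Pi.single 0 ((1 : ℕ) : ZMod L)) i j)).trace.re)
      - wilsonExpectation ρ β (fun U : GaugeConfig d L G => (ρ (plaquetteHolonomy U x i j)).trace.re)
        * wilsonExpectation ρ β (fun U : GaugeConfig d L G =>
          (ρ (plaquetteHolonomy U (x + Pi.single 0 ((1 : ℕ) : ZMod L)) i j)).trace.re) := by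
  rw [conjCorr_eq_tCorr' ρ β x i j 1, Nat.cast_one]
  exact corr_one_nonneg ρ hL2 hρ hβ (by simp) hi hj

/-- **THE SIGNED, EXPLICIT-RATE CLUSTERING FLOOR ON ONE TORUS.**  For continuous `ρ`, `β ≥ 0`,
`L ≥ 3`, a spatial orientation `i, j ≠ 0` and `δ > 0`: a floor `δ` under the separation-one
truncated temporal correlator at every site of this torus forces
`δ·(δ/N²)ˢ ≤ ⟨P_x P_{x + s e₀}⟩ − ⟨P_x⟩⟨P_{x + s e₀}⟩` for every `s ≤ L − 1` and every site `x`. -/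
theorem conjCorr_ge_geometric (hL3 : 3 ≤ L) (hρ : Continuous ρ) {β : ℝ} (hβ : 0 ≤ β) {i j : Fin d}
    (hi : i ≠ 0) (hj : j ≠ 0) {δ : ℝ} (hδ : 0 < δ)
    (hU : ∀ y : Site d L, δ ≤ |wilsonExpectation ρ β (fun U : GaugeConfig d L G =>
        (ρ (plaquetteHolonomy U y i j)).trace.re
          * (ρ (plaquetteHolonomy U (y + Pi.single 0 ((1 : ℕ) : ZMod L)) i j)).trace.re)
      - wilsonExpectation ρ β (fun U : GaugeConfig d L G => (ρ (plaquetteHolonomy U y i j)).trace.re)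
        * wilsonExpectation ρ β (fun U : GaugeConfig d L G =>
          (ρ (plaquetteHolonomy U (y + Pi.single 0 ((1 : ℕ) : ZMod L)) i j)).trace.re)|)
    {s : ℕ} (hs : s + 1 ≤ L) (x : Site d L) :
    δ * (δ / (N : ℝ) ^ 2) ^ s ≤ wilsonExpectation ρ β (fun U : GaugeConfig d L G =>
        (ρ (plaquetteHolonomy U x i j)).trace.re
          * (ρ (plaquetteHolonomy U (x + Pi.single 0 ((s : ℕ) : ZMod L)) i j)).trace.re)
      - wilsonExpectation ρ β (fun U : GaugeConfig d L G => (ρ (plaquetteHolonomy U x i j)).trace.re)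
        * wilsonExpectation ρ β (fun U : GaugeConfig d L G =>
          (ρ (plaquetteHolonomy U (x + Pi.single 0 ((s : ℕ) : ZMod L)) i j)).trace.re) := by
  set x₀ : Site d L := x - Pi.single (0 : Fin d) (x 0) with hx₀
  have hx₀0 : x₀ 0 = 0 := by simp [hx₀]
  have h1 : δ ≤ tCorr ρ β x₀ i j 1 := by
    have h := hU x₀
    have hnn := conjCorr_nonneg_one ρ (by omega) hρ hβ hi hj x₀
    rw [abs_of_nonneg hnn] at h
    rw [conjCorr_eq_tCorr' ρ β x₀ i j 1, Nat.cast_one] at h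
    have e0 : x₀ - Pi.single (0 : Fin d) (x₀ 0) = x₀ := by rw [hx₀0, Pi.single_zero, sub_zero]
    rwa [e0] at h
  rw [conjCorr_eq_tCorr' ρ β x i j s]
  exact tCorr_ge_geometric ρ hL3 hρ hβ hx₀0 hi hj hδ h1 hs

end Summit.Ventures.LatticeQCDFlow.Theory2.Clustering
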